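import Summits.RiemannHypothesis.RiemannHypothesis.Theses.WeilGroundState
import Literature.NumberTheory.LFunctions.WeilGroundStateRealZerosProofs

/-!
# Route `WeilGroundState`, item `GroundStateMellinRealZeros` (stmt-RiemannHypothesis-1528)

The support statement `GroundStateMellinRealZeros` of route `RiemannHypothesis/WeilGroundState` is
Connes–van Suijlekom 2025, Thm. 6.1 (= Connes 2026, §6.1) in the tree's normalisation: at a window
`a > 0` whose bottom is simple, isolated and even (the window-`a` clause of `GroundStateSimpleEven`,
which is verbatim `Literature.NumberTheory.LFunctions.WeilWindowSimpleEven a`), every ground state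
`u` (verbatim `Literature.NumberTheory.LFunctions.IsWeilGroundState a u`, curried) has an entire
Mellin–Laplace transform `weilMellin u` all of whose zeros lie on `Re s = 1/2`.

The named fact `Literature.NumberTheory.LFunctions.Connes2026_weilGroundState_zeros_re_eq_half`
is DISCHARGED in the tree
(`Literature.NumberTheory.LFunctions.Connes2026_weilGroundState_zeros_re_eq_half_holds`,
`Literature/NumberTheory/LFunctions/WeilGroundStateRealZerosProofs.lean`, a continuum form of the
C–vS mechanism), and entirety is `IsWeilGroundState.differentiable_weilMellin`; so the item closes
unconditionally by unfolding. (Candidate proof of grounder g15-23, evidence `WGSProofs.lean`, made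
unconditional.)

References: [ConnesSuijlekom2025] Thm. 6.1; [Connes2026Letter] §5, §6.1.
-/

namespace Summit.RiemannHypothesis.RiemannHypothesis.Theorems

open Literature.NumberTheory.LFunctions

/-- **`GroundStateMellinRealZeros` holds** (route `WeilGroundState`, item stmt-RiemannHypothesis-1528):
for every window `a > 0` at which the bottom of the truncated Weil form is simple, isolated and
even, every ground state `u` of the window has `weilMellin u` entire with all its zeros on
`Re s = 1/2`. Proof: the hypothesis clause is `WeilWindowSimpleEven a` and the ground-state clause
is `IsWeilGroundState a u` (both by `Iff.rfl`); apply the discharged fact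
`Connes2026_weilGroundState_zeros_re_eq_half_holds` (Connes–van Suijlekom 2025, Thm. 6.1) through
`Connes2026_weilGroundState_zeros_re_eq_half.differentiable_and_zeros`. -/
theorem groundStateMellinRealZeros_proof :
    Summit.RiemannHypothesis.RiemannHypothesis.Theses.WeilGroundState.GroundStateMellinRealZeros := by
  unfold Summit.RiemannHypothesis.RiemannHypothesis.Theses.WeilGroundState.GroundStateMellinRealZeros
  intro a _ hwin u hu hg
  exact Connes2026_weilGroundState_zeros_re_eq_half_holds.differentiable_and_zeros
    (a := a) hwin (u := u) ⟨hu, hg⟩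

end Summit.RiemannHypothesis.RiemannHypothesis.Theorems
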